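import Mathlib
import HarnessLib
import Summits.MatrixMultiplication.MatrixMultiplication.Theses.SnSubsetDichotomy

/-!
# Line `per-host-descent-rooted-triangles` — skeleton for crux `HyperoctahedralSubsets`
(stmt-MatrixMultiplication-8305, route SnSubsetDichotomy, rank 4)

Per-host global/junta DESCENT at fixed `n` inside ROOTED HOSTS
`K(μ) = {σ : σμ = μσ ∧ σ fixes Fix μ pointwise}` (`μ` any involution; `μ` fpf ⇒ `K(μ) = C(μ) ≅ S₂ ≀ S_{n/2}`),
ending in a 3-wise COUNT: supersaturated host triangles (`stub_hostTriangles`, TPP-free character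
estimate) × a relative counting lemma for λ-global hosted sets (`stub_relativeCounting`, the bet),
against the diagonal sextuple count forced by the TPP (proved here) — composed in
`HyperoctahedralSubsets_of` (sorry-free). Stubs: `stub_saturate` (junta half: density increment on
point-umvirates, provable now), `stub_packing` (pairwise packing + host size, provable now),
`stub_hostTriangles`, `stub_relativeCounting` (hardest). See `Lines/per-host-descent-rooted-triangles.md`.
-/

open scoped BigOperators Classical
open Finset

namespace Summit.MatrixMultiplication.MatrixMultiplication.Cruxes.HyperoctahedralSubsets.PerHostDescentRootedTriangles

open Literature.Combinatorics.Additive (TripleProductProperty)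

/-! ## The four stubs

Notation used informally in the docstrings (everything is written out in the statements):
* `Host μ σ :≡ σ * μ = μ * σ ∧ ∀ x, μ x = x → σ x = x` — `σ` lies in the ROOTED HOST `K(μ)`;
* `K(μ) :≡ univ.filter (Host μ)`, `fix μ :≡ #{x | μ x = x}`;
* `λ`-GLOBAL `X ⊆ K(μ)`: for every `t` and every point-umvirate `U = {σ | ∀ k, σ (a k) = b k}`
  (`a : Fin t → Fin n` injective), `|X ∩ U|·|K(μ)| ≤ λ^t·|X|·|K(μ) ∩ U|`;
* `N(μ) :≡ #{(k₀,k₁) ∈ K(μ 0) × K(μ 1) | k₀k₁ ∈ K(μ 2)}` (host triangles `k₀k₁k₂ = 1`);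
* `S6(X) :≡ #{(x₀,x₀',x₁,x₁',x₂,x₂') ∈ X₀²×X₁²×X₂² | x₀x₀'⁻¹(x₁x₁'⁻¹)(x₂x₂'⁻¹) = 1}`.
-/

/-- **stub_saturate** (JUNTA HALF of the in-host dichotomy; provable now, size L).
Iterate point-umvirate density increments inside the rooted hosts: whenever some `X i` has
`|X i ∩ U|·|K(μ i)| > λ^t·|X i|·|K(μ i) ∩ U|` for a `t`-point umvirate `U = {σ | σ ∘ a = b}`, replace
`X i` by a right translate of `X i ∩ U`, which is hosted by `K(μ')`, `μ' = μ i` with the pairs through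
`range b` deleted (`Q(X ∩ U) ⊆ K(μ i) ∩ Stab(range b ∪ μ(range b))`); TPP is hereditary and invariant
under right translation of each set. Output: a `λ`-global hosted TPP triple at the SAME `n` with
(a) density product not decreased, (b) root budget `λ^{Σ fix μ'}·(∏|X|)² ≤ λ^{Σ fix μ}·(∏|K(μ)|)²`
(each step gains `> λ^t` and adds `≤ 2t` fixed points), (c) host cost `∏|K(μ)| ≤ n^{Σ fix μ'}·∏|K(μ')|`. -/
theorem stub_saturate (lam : ℝ) (hlam : 1 < lam) (n : ℕ) (μ : Fin 3 → Equiv.Perm (Fin n))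
    (X : Fin 3 → Finset (Equiv.Perm (Fin n)))
    (hμ : ∀ i, μ i * μ i = 1)
    (hX : ∀ i, ∀ σ ∈ X i, σ * μ i = μ i * σ ∧ ∀ x, μ i x = x → σ x = x)
    (hne : ∀ i, (X i).Nonempty)
    (hT : TripleProductProperty (X 0) (X 1) (X 2)) :
    ∃ (μ' : Fin 3 → Equiv.Perm (Fin n)) (X' : Fin 3 → Finset (Equiv.Perm (Fin n))),
      (∀ i, μ' i * μ' i = 1) ∧
      (∀ i, ∀ σ ∈ X' i, σ * μ' i = μ' i * σ ∧ ∀ x, μ' i x = x → σ x = x) ∧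
      (∀ i, (X' i).Nonempty) ∧
      TripleProductProperty (X' 0) (X' 1) (X' 2) ∧
      (∀ i, ∀ (t : ℕ) (a b : Fin t → Fin n), Function.Injective a →
        (((X' i).filter (fun σ => ∀ k, σ (a k) = b k)).card : ℝ) *
            (univ.filter (fun σ : Equiv.Perm (Fin n) =>
              σ * μ' i = μ' i * σ ∧ ∀ x, μ' i x = x → σ x = x)).card ≤
          lam ^ t * (X' i).card *
            (univ.filter (fun σ : Equiv.Perm (Fin n) =>
              (σ * μ' i = μ' i * σ ∧ ∀ x, μ' i x = x → σ x = x) ∧ ∀ k, σ (a k) = b k)).card) ∧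
      (∏ i, ((X i).card : ℝ)) *
          (∏ i, ((univ.filter (fun σ : Equiv.Perm (Fin n) =>
            σ * μ' i = μ' i * σ ∧ ∀ x, μ' i x = x → σ x = x)).card : ℝ)) ≤
        (∏ i, ((X' i).card : ℝ)) *
          (∏ i, ((univ.filter (fun σ : Equiv.Perm (Fin n) =>
            σ * μ i = μ i * σ ∧ ∀ x, μ i x = x → σ x = x)).card : ℝ)) ∧
      lam ^ (∑ i, (univ.filter (fun x : Fin n => μ' i x = x)).card) * (∏ i, ((X i).card : ℝ)) ^ 2 ≤
        lam ^ (∑ i, (univ.filter (fun x : Fin n => μ i x = x)).card) *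
          (∏ i, ((univ.filter (fun σ : Equiv.Perm (Fin n) =>
            σ * μ i = μ i * σ ∧ ∀ x, μ i x = x → σ x = x)).card : ℝ)) ^ 2 ∧
      (∏ i, ((univ.filter (fun σ : Equiv.Perm (Fin n) =>
            σ * μ i = μ i * σ ∧ ∀ x, μ i x = x → σ x = x)).card : ℝ)) ≤
        (n : ℝ) ^ (∑ i, (univ.filter (fun x : Fin n => μ' i x = x)).card) *
          (∏ i, ((univ.filter (fun σ : Equiv.Perm (Fin n) =>
            σ * μ' i = μ' i * σ ∧ ∀ x, μ' i x = x → σ x = x)).card : ℝ)) := by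
  sorry

/-- **stub_packing** (PAIRWISE PACKING in rooted hosts + host size; provable now, size M).
(i) Under the TPP the map `(x_i, x_j) ↦ x_i⁻¹ x_j` is injective on `X i × X j` (pairwise form of the
TPP, any two of the three slots) with image in the product set `K(μ i)·K(μ j)`, whose size is
`|K(μ i)|·|K(μ j)|/|K(μ i) ∩ K(μ j)|` (`K(μ)` is a subgroup); hence
`|X i|·|X j|·|K(μ i) ∩ K(μ j)| ≤ |K(μ i)|·|K(μ j)|`.
(ii) `|K(μ)| = 2^{m'}·m'!` with `m'` the number of 2-cycles of the involution `μ`, and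
`4^{m'}(m'!)² ≤ (2m'+1)! ≤ (n+1)!`, so `|K(μ)|² ≤ (n+1)·n!` (the knife edge `|B_m| ≈ √(n!)(πn/2)^{1/4}`). -/
theorem stub_packing (n : ℕ) (μ : Fin 3 → Equiv.Perm (Fin n))
    (X : Fin 3 → Finset (Equiv.Perm (Fin n)))
    (hμ : ∀ i, μ i * μ i = 1)
    (hX : ∀ i, ∀ σ ∈ X i, σ * μ i = μ i * σ ∧ ∀ x, μ i x = x → σ x = x)
    (hT : TripleProductProperty (X 0) (X 1) (X 2)) :
    (∀ i j, i ≠ j →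
        ((X i).card : ℝ) * (X j).card *
            (univ.filter (fun σ : Equiv.Perm (Fin n) =>
              (σ * μ i = μ i * σ ∧ ∀ x, μ i x = x → σ x = x) ∧
              (σ * μ j = μ j * σ ∧ ∀ x, μ j x = x → σ x = x))).card ≤
          ((univ.filter (fun σ : Equiv.Perm (Fin n) =>
              σ * μ i = μ i * σ ∧ ∀ x, μ i x = x → σ x = x)).card : ℝ) *
            (univ.filter (fun σ : Equiv.Perm (Fin n) =>
              σ * μ j = μ j * σ ∧ ∀ x, μ j x = x → σ x = x)).card) ∧
    (∀ i, ((univ.filter (fun σ : Equiv.Perm (Fin n) =>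
              σ * μ i = μ i * σ ∧ ∀ x, μ i x = x → σ x = x)).card : ℝ) ^ 2 ≤
        ((n + 1 : ℕ) : ℝ) * (n.factorial : ℝ)) := by
  sorry

/-- **stub_hostTriangles** (SUPERSATURATED HOST TRIANGLES = `RootedSolutions` quantified; TPP-free,
size L). For three involutions with `≤ C_F√n` fixed points each, in pairwise LONG-CYCLE position
(`|K(μ i) ∩ K(μ j)| ≤ e^{C₀√n}`, the complement of the packing regime), the number of host triangles
`N = #{(k₀,k₁) ∈ K(μ 0) × K(μ 1) | k₀k₁ ∈ K(μ 2)}` is at least half the random count: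
`2·n!·N ≥ ∏|K(μ i)|`. Mechanism: `N·n!/∏|K| = Σ_ρ d_ρ tr(P₀P₁P₂)` (`P_i` = projection on
`K(μ i)`-invariants of `ρ ∈ Irr S_n`), trivial `ρ` gives `1`, and at long-cycle coset types the
spherical functions of `(S_{2m}, B_m)` (Macdonald 1995 VII.2 (2.24), Ex. 2) make
`Σ_{ρ ≠ 1} d_ρ|tr(P₀P₁P₂)| = O(1/n)` level by level (`f^{2λ} ~ m^{2k}`, `|ω^λ_τ|³ ~ m^{-3k}` at level `k`).
Numerics: all `n³` root triples solvable at `n = 10, 12, 14` (j004980); `N ∈ [16,148]` vs random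
`15.6` over the 125 rooted AP triples at `n = 10` (triage r1-2 §C). -/
theorem stub_hostTriangles (CF : ℝ) (hCF : 0 < CF) :
    ∃ C₀ : ℝ, 0 < C₀ ∧ ∃ n₀ : ℕ, ∀ n ≥ n₀, ∀ μ : Fin 3 → Equiv.Perm (Fin n),
      (∀ i, μ i * μ i = 1) →
      (∀ i, ((univ.filter (fun x : Fin n => μ i x = x)).card : ℝ) ≤ CF * Real.sqrt n) →
      (∀ i j, i ≠ j →
        ((univ.filter (fun σ : Equiv.Perm (Fin n) =>
            (σ * μ i = μ i * σ ∧ ∀ x, μ i x = x → σ x = x) ∧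
            (σ * μ j = μ j * σ ∧ ∀ x, μ j x = x → σ x = x))).card : ℝ) ≤
          Real.exp (C₀ * Real.sqrt n)) →
      (∏ i, ((univ.filter (fun σ : Equiv.Perm (Fin n) =>
          σ * μ i = μ i * σ ∧ ∀ x, μ i x = x → σ x = x)).card : ℝ)) ≤
        2 * (n.factorial : ℝ) *
          (((univ.filter (fun σ : Equiv.Perm (Fin n) =>
                σ * μ 0 = μ 0 * σ ∧ ∀ x, μ 0 x = x → σ x = x)) ×ˢ
              (univ.filter (fun σ : Equiv.Perm (Fin n) =>
                σ * μ 1 = μ 1 * σ ∧ ∀ x, μ 1 x = x → σ x = x))).filter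
            (fun p => p.1 * p.2 * μ 2 = μ 2 * (p.1 * p.2) ∧
              ∀ x, μ 2 x = x → (p.1 * p.2) x = x)).card := by
  sorry

/-- **stub_relativeCounting** (RELATIVE COUNTING FOR GLOBAL HOSTED SETS — the bet of the line,
hardest stub; TPP-free). There is a globalness strength `λ > 1` such that, for every root budget
`C_F√n`, density floor `∏|X i| ≥ e^{-C_d√n}∏|K(μ i)|` and long-cycle position
`|K(μ i) ∩ K(μ j)| ≤ e^{C_z√n}` (all three are what the composition supplies),
`λ`-global nonempty sets `X i ⊆ K(μ i)` realise at least an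
`e^{-C√n}·(∏ |X i|/|K(μ i)|)^A` fraction of the host sextuple count `N·∏|K(μ i)|`:
`S6(X)·(∏|K|)^A·e^{C√n} ≥ (∏|X|)^A·N·∏|K|`, where `S6(X)` counts the solutions of the TPP word
`x₀x₀'⁻¹(x₁x₁'⁻¹)(x₂x₂'⁻¹) = 1` in `X₀²×X₁²×X₂²` (for `X i = K(μ i)` equality holds with no loss).
Replaces the idea card's `QuotientCoversRootedHost` (false below depth `2m^{3/4}`: parity sets
`A × S_m`, torus Hamming ball — triage r1-1/r1-3), which it does not need: the parity sets have
sextuple ratio `1 − 2^{-m+O(√m)}` and the Hamming ball only a constant-factor depletion.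
Intended mechanism: expand `r_i = 1_{X i} ∗ 1_{X i⁻¹}` (PSD Fourier transform) by host level; the main
term is `N`; pair terms = level-`t` inequalities for `λ`-global functions on `S₂ ≀ S_m`
(Keevash–Lifshitz–Long–Minzer arXiv:1906.05568 / Filmus–Kindler–Lifshitz–Minzer arXiv:2009.05503,
effective since `log(1/α) = O(√n) ≪ m`) × smallness of the principal angles `‖P_iP_j‖` on high-level
irreps (size, not vanishing, of `ω^λ_τ`); the fully trilinear high-level term has no published
engine — that is the open content. -/
theorem stub_relativeCounting :
    ∃ lam : ℝ, 1 < lam ∧ ∀ CF : ℝ, 0 < CF → ∀ Cd : ℝ, 0 < Cd → ∀ Cz : ℝ, 0 < Cz →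
      ∃ A : ℕ, 2 ≤ A ∧ ∃ C : ℝ, ∃ n₀ : ℕ, ∀ n ≥ n₀,
      ∀ μ : Fin 3 → Equiv.Perm (Fin n), ∀ X : Fin 3 → Finset (Equiv.Perm (Fin n)),
      (∀ i, μ i * μ i = 1) →
      (∀ i, ∀ σ ∈ X i, σ * μ i = μ i * σ ∧ ∀ x, μ i x = x → σ x = x) →
      (∀ i, (X i).Nonempty) →
      (∀ i, ((univ.filter (fun x : Fin n => μ i x = x)).card : ℝ) ≤ CF * Real.sqrt n) →
      ((∏ i, ((univ.filter (fun σ : Equiv.Perm (Fin n) =>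
          σ * μ i = μ i * σ ∧ ∀ x, μ i x = x → σ x = x)).card : ℝ)) ≤
        Real.exp (Cd * Real.sqrt n) * ∏ i, ((X i).card : ℝ)) →
      (∀ i j, i ≠ j →
        ((univ.filter (fun σ : Equiv.Perm (Fin n) =>
            (σ * μ i = μ i * σ ∧ ∀ x, μ i x = x → σ x = x) ∧
            (σ * μ j = μ j * σ ∧ ∀ x, μ j x = x → σ x = x))).card : ℝ) ≤
          Real.exp (Cz * Real.sqrt n)) →
      (∀ i, ∀ (t : ℕ) (a b : Fin t → Fin n), Function.Injective a →
        (((X i).filter (fun σ => ∀ k, σ (a k) = b k)).card : ℝ) *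
            (univ.filter (fun σ : Equiv.Perm (Fin n) =>
              σ * μ i = μ i * σ ∧ ∀ x, μ i x = x → σ x = x)).card ≤
          lam ^ t * (X i).card *
            (univ.filter (fun σ : Equiv.Perm (Fin n) =>
              (σ * μ i = μ i * σ ∧ ∀ x, μ i x = x → σ x = x) ∧ ∀ k, σ (a k) = b k)).card) →
      (∏ i, ((X i).card : ℝ)) ^ A *
          (((univ.filter (fun σ : Equiv.Perm (Fin n) =>
                σ * μ 0 = μ 0 * σ ∧ ∀ x, μ 0 x = x → σ x = x)) ×ˢ
              (univ.filter (fun σ : Equiv.Perm (Fin n) =>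
                σ * μ 1 = μ 1 * σ ∧ ∀ x, μ 1 x = x → σ x = x))).filter
            (fun p => p.1 * p.2 * μ 2 = μ 2 * (p.1 * p.2) ∧
              ∀ x, μ 2 x = x → (p.1 * p.2) x = x)).card *
          (∏ i, ((univ.filter (fun σ : Equiv.Perm (Fin n) =>
            σ * μ i = μ i * σ ∧ ∀ x, μ i x = x → σ x = x)).card : ℝ)) ≤
        ((((X 0 ×ˢ X 0) ×ˢ ((X 1 ×ˢ X 1) ×ˢ (X 2 ×ˢ X 2))).filter
            (fun p => p.1.1 * p.1.2⁻¹ * (p.2.1.1 * p.2.1.2⁻¹) * (p.2.2.1 * p.2.2.2⁻¹) = 1)).card : ℝ) *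
          (∏ i, ((univ.filter (fun σ : Equiv.Perm (Fin n) =>
            σ * μ i = μ i * σ ∧ ∀ x, μ i x = x → σ x = x)).card : ℝ)) ^ A *
          Real.exp (C * Real.sqrt n) := by
  sorry

/-! ## Composition (sorry-free below this line)

Local abbreviations (definitionally equal to the expressions written out in the stubs). -/

/-- The rooted host `K(ν)` of an involution `ν`, as a finset. -/
noncomputable def hostSet (n : ℕ) (ν : Equiv.Perm (Fin n)) : Finset (Equiv.Perm (Fin n)) :=
  univ.filter (fun σ : Equiv.Perm (Fin n) => σ * ν = ν * σ ∧ ∀ x, ν x = x → σ x = x)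

/-- Number of fixed points of `ν`. -/
noncomputable def fixCard (n : ℕ) (ν : Equiv.Perm (Fin n)) : ℕ :=
  (univ.filter (fun x : Fin n => ν x = x)).card

/-- `|K(ν) ∩ K(ν')|`. -/
noncomputable def interCard (n : ℕ) (ν ν' : Equiv.Perm (Fin n)) : ℕ :=
  (univ.filter (fun σ : Equiv.Perm (Fin n) =>
    (σ * ν = ν * σ ∧ ∀ x, ν x = x → σ x = x) ∧ (σ * ν' = ν' * σ ∧ ∀ x, ν' x = x → σ x = x))).card

/-- Host triangle count `N(μ) = #{(k₀,k₁) ∈ K(μ 0) × K(μ 1) | k₀k₁ ∈ K(μ 2)}`. -/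
noncomputable def triN (n : ℕ) (μ : Fin 3 → Equiv.Perm (Fin n)) : ℕ :=
  (((univ.filter (fun σ : Equiv.Perm (Fin n) => σ * μ 0 = μ 0 * σ ∧ ∀ x, μ 0 x = x → σ x = x)) ×ˢ
      (univ.filter (fun σ : Equiv.Perm (Fin n) =>
        σ * μ 1 = μ 1 * σ ∧ ∀ x, μ 1 x = x → σ x = x))).filter
    (fun p => p.1 * p.2 * μ 2 = μ 2 * (p.1 * p.2) ∧ ∀ x, μ 2 x = x → (p.1 * p.2) x = x)).card

/-- Sextuple count `S6(X)`: solutions of the TPP word in `X₀² × X₁² × X₂²`. -/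
noncomputable def sexN (n : ℕ) (X : Fin 3 → Finset (Equiv.Perm (Fin n))) : ℕ :=
  (((X 0 ×ˢ X 0) ×ˢ ((X 1 ×ˢ X 1) ×ˢ (X 2 ×ˢ X 2))).filter
    (fun p => p.1.1 * p.1.2⁻¹ * (p.2.1.1 * p.2.1.2⁻¹) * (p.2.2.1 * p.2.2.2⁻¹) = 1)).card

/-! ### The stubs, restated through the abbreviations (proofs: the stubs, by `rfl`-unfolding) -/

theorem saturate' (lam : ℝ) (hlam : 1 < lam) (n : ℕ) (μ : Fin 3 → Equiv.Perm (Fin n))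
    (X : Fin 3 → Finset (Equiv.Perm (Fin n)))
    (hμ : ∀ i, μ i * μ i = 1)
    (hX : ∀ i, ∀ σ ∈ X i, σ * μ i = μ i * σ ∧ ∀ x, μ i x = x → σ x = x)
    (hne : ∀ i, (X i).Nonempty)
    (hT : TripleProductProperty (X 0) (X 1) (X 2)) :
    ∃ (μ' : Fin 3 → Equiv.Perm (Fin n)) (X' : Fin 3 → Finset (Equiv.Perm (Fin n))),
      (∀ i, μ' i * μ' i = 1) ∧
      (∀ i, ∀ σ ∈ X' i, σ * μ' i = μ' i * σ ∧ ∀ x, μ' i x = x → σ x = x) ∧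
      (∀ i, (X' i).Nonempty) ∧
      TripleProductProperty (X' 0) (X' 1) (X' 2) ∧
      (∀ i, ∀ (t : ℕ) (a b : Fin t → Fin n), Function.Injective a →
        (((X' i).filter (fun σ => ∀ k, σ (a k) = b k)).card : ℝ) * (hostSet n (μ' i)).card ≤
          lam ^ t * (X' i).card *
            (univ.filter (fun σ : Equiv.Perm (Fin n) =>
              (σ * μ' i = μ' i * σ ∧ ∀ x, μ' i x = x → σ x = x) ∧ ∀ k, σ (a k) = b k)).card) ∧
      (∏ i, ((X i).card : ℝ)) * (∏ i, ((hostSet n (μ' i)).card : ℝ)) ≤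
        (∏ i, ((X' i).card : ℝ)) * (∏ i, ((hostSet n (μ i)).card : ℝ)) ∧
      lam ^ (∑ i, fixCard n (μ' i)) * (∏ i, ((X i).card : ℝ)) ^ 2 ≤
        lam ^ (∑ i, fixCard n (μ i)) * (∏ i, ((hostSet n (μ i)).card : ℝ)) ^ 2 ∧
      (∏ i, ((hostSet n (μ i)).card : ℝ)) ≤
        (n : ℝ) ^ (∑ i, fixCard n (μ' i)) * (∏ i, ((hostSet n (μ' i)).card : ℝ)) :=
  stub_saturate lam hlam n μ X hμ hX hne hT

theorem packing' (n : ℕ) (μ : Fin 3 → Equiv.Perm (Fin n))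
    (X : Fin 3 → Finset (Equiv.Perm (Fin n)))
    (hμ : ∀ i, μ i * μ i = 1)
    (hX : ∀ i, ∀ σ ∈ X i, σ * μ i = μ i * σ ∧ ∀ x, μ i x = x → σ x = x)
    (hT : TripleProductProperty (X 0) (X 1) (X 2)) :
    (∀ i j, i ≠ j →
        ((X i).card : ℝ) * (X j).card * (interCard n (μ i) (μ j)) ≤
          ((hostSet n (μ i)).card : ℝ) * (hostSet n (μ j)).card) ∧
    (∀ i, ((hostSet n (μ i)).card : ℝ) ^ 2 ≤ ((n + 1 : ℕ) : ℝ) * (n.factorial : ℝ)) :=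
  stub_packing n μ X hμ hX hT

theorem hostTriangles' (CF : ℝ) (hCF : 0 < CF) :
    ∃ C₀ : ℝ, 0 < C₀ ∧ ∃ n₀ : ℕ, ∀ n ≥ n₀, ∀ μ : Fin 3 → Equiv.Perm (Fin n),
      (∀ i, μ i * μ i = 1) →
      (∀ i, (fixCard n (μ i) : ℝ) ≤ CF * Real.sqrt n) →
      (∀ i j, i ≠ j → (interCard n (μ i) (μ j) : ℝ) ≤ Real.exp (C₀ * Real.sqrt n)) →
      (∏ i, ((hostSet n (μ i)).card : ℝ)) ≤ 2 * (n.factorial : ℝ) * (triN n μ : ℝ) :=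
  stub_hostTriangles CF hCF

theorem relativeCounting' :
    ∃ lam : ℝ, 1 < lam ∧ ∀ CF : ℝ, 0 < CF → ∀ Cd : ℝ, 0 < Cd → ∀ Cz : ℝ, 0 < Cz →
      ∃ A : ℕ, 2 ≤ A ∧ ∃ C : ℝ, ∃ n₀ : ℕ, ∀ n ≥ n₀,
      ∀ μ : Fin 3 → Equiv.Perm (Fin n), ∀ X : Fin 3 → Finset (Equiv.Perm (Fin n)),
      (∀ i, μ i * μ i = 1) →
      (∀ i, ∀ σ ∈ X i, σ * μ i = μ i * σ ∧ ∀ x, μ i x = x → σ x = x) →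
      (∀ i, (X i).Nonempty) →
      (∀ i, (fixCard n (μ i) : ℝ) ≤ CF * Real.sqrt n) →
      ((∏ i, ((hostSet n (μ i)).card : ℝ)) ≤ Real.exp (Cd * Real.sqrt n) * ∏ i, ((X i).card : ℝ)) →
      (∀ i j, i ≠ j → (interCard n (μ i) (μ j) : ℝ) ≤ Real.exp (Cz * Real.sqrt n)) →
      (∀ i, ∀ (t : ℕ) (a b : Fin t → Fin n), Function.Injective a →
        (((X i).filter (fun σ => ∀ k, σ (a k) = b k)).card : ℝ) * (hostSet n (μ i)).card ≤
          lam ^ t * (X i).card *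
            (univ.filter (fun σ : Equiv.Perm (Fin n) =>
              (σ * μ i = μ i * σ ∧ ∀ x, μ i x = x → σ x = x) ∧ ∀ k, σ (a k) = b k)).card) →
      (∏ i, ((X i).card : ℝ)) ^ A * (triN n μ : ℝ) * (∏ i, ((hostSet n (μ i)).card : ℝ)) ≤
        (sexN n X : ℝ) * (∏ i, ((hostSet n (μ i)).card : ℝ)) ^ A * Real.exp (C * Real.sqrt n) :=
  stub_relativeCounting

/-! ### Elementary lemmas -/

theorem subset_hostSet {n : ℕ} (ν : Equiv.Perm (Fin n)) (Y : Finset (Equiv.Perm (Fin n)))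
    (hY : ∀ σ ∈ Y, σ * ν = ν * σ ∧ ∀ x, ν x = x → σ x = x) : Y ⊆ hostSet n ν := by
  intro σ hσ
  unfold hostSet
  rw [Finset.mem_filter]
  exact ⟨Finset.mem_univ _, hY σ hσ⟩

theorem fixCard_eq_zero {n : ℕ} (ν : Equiv.Perm (Fin n)) (h : ∀ x, ν x ≠ x) :
    fixCard n ν = 0 := by
  unfold fixCard
  rw [Finset.card_eq_zero, Finset.filter_eq_empty_iff]
  intro x _
  exact h x

theorem prod_three_split (i j : Fin 3) (hij : i ≠ j) :
    ∃ k : Fin 3, ∀ f : Fin 3 → ℝ, ∏ l, f l = f i * f j * f k := by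
  fin_cases i <;> fin_cases j
  · exact absurd rfl hij
  · exact ⟨2, fun f => by simp only [Fin.prod_univ_three, Fin.isValue, Fin.zero_eta, Fin.mk_one]⟩
  · exact ⟨1, fun f => by simp only [Fin.prod_univ_three, Fin.isValue, Fin.zero_eta, Fin.reduceFinMk]; ring⟩
  · exact ⟨2, fun f => by simp only [Fin.prod_univ_three, Fin.isValue, Fin.zero_eta, Fin.mk_one]; ring⟩
  · exact absurd rfl hij
  · exact ⟨0, fun f => by simp only [Fin.prod_univ_three, Fin.isValue, Fin.mk_one, Fin.reduceFinMk]; ring⟩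
  · exact ⟨1, fun f => by simp only [Fin.prod_univ_three, Fin.isValue, Fin.zero_eta, Fin.reduceFinMk]; ring⟩
  · exact ⟨0, fun f => by simp only [Fin.prod_univ_three, Fin.isValue, Fin.mk_one, Fin.reduceFinMk]; ring⟩
  · exact absurd rfl hij

/-- TPP ⇒ every solution of the sextuple equation is diagonal, so `S6(X) ≤ ∏ |X i|`. -/
theorem sextuple_card_le (n : ℕ) (X : Fin 3 → Finset (Equiv.Perm (Fin n)))
    (hT : TripleProductProperty (X 0) (X 1) (X 2)) :
    (sexN n X : ℝ) ≤ ∏ i, ((X i).card : ℝ) := by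
  have h : sexN n X ≤ (X 0 ×ˢ (X 1 ×ˢ X 2)).card := by
    unfold sexN
    refine Finset.card_le_card_of_injOn (fun p => (p.1.1, p.2.1.1, p.2.2.1)) ?_ ?_
    · intro p hp
      simp only [Finset.coe_filter, Set.mem_setOf_eq, Finset.mem_product] at hp
      simp only [Finset.coe_product, Set.mem_prod, Finset.mem_coe]
      exact ⟨hp.1.1.1, hp.1.2.1.1, hp.1.2.2.1⟩
    · intro p hp q hq hpq
      simp only [Finset.coe_filter, Set.mem_setOf_eq, Finset.mem_product] at hp hq
      obtain ⟨⟨⟨hp00, hp01⟩, ⟨hp10, hp11⟩, ⟨hp20, hp21⟩⟩, hpe⟩ := hp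
      obtain ⟨⟨⟨hq00, hq01⟩, ⟨hq10, hq11⟩, ⟨hq20, hq21⟩⟩, hqe⟩ := hq
      obtain ⟨ep0, ep1, ep2⟩ := hT _ hp00 _ hp01 _ hp10 _ hp11 _ hp20 _ hp21 hpe
      obtain ⟨eq0, eq1, eq2⟩ := hT _ hq00 _ hq01 _ hq10 _ hq11 _ hq20 _ hq21 hqe
      simp only [Prod.mk.injEq] at hpq
      obtain ⟨e0, e1, e2⟩ := hpq
      exact Prod.ext (Prod.ext e0 (ep0.symm.trans (e0.trans eq0)))
        (Prod.ext (Prod.ext e1 (ep1.symm.trans (e1.trans eq1)))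
          (Prod.ext e2 (ep2.symm.trans (e2.trans eq2))))
  have h2 : ((X 0 ×ˢ (X 1 ×ˢ X 2)).card : ℝ) = ∏ i, ((X i).card : ℝ) := by
    rw [Finset.card_product, Finset.card_product, Fin.prod_univ_three]
    push_cast
    ring
  calc (sexN n X : ℝ) ≤ ((X 0 ×ˢ (X 1 ×ˢ X 2)).card : ℝ) := by exact_mod_cast h
    _ = _ := h2

theorem log_succ_le_four_sqrt (n : ℕ) (hn : 1 ≤ n) :
    Real.log ((n : ℝ) + 1) ≤ 4 * Real.sqrt n := by
  have hn1 : (1 : ℝ) ≤ n := by exact_mod_cast hn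
  have h1 := Real.log_le_rpow_div (x := (n : ℝ) + 1) (by positivity) (by norm_num : (0 : ℝ) < 1 / 2)
  rw [← Real.sqrt_eq_rpow] at h1
  have h2 : Real.sqrt ((n : ℝ) + 1) ≤ 2 * Real.sqrt n := by
    rw [Real.sqrt_le_iff]
    refine ⟨by positivity, ?_⟩
    rw [mul_pow, Real.sq_sqrt (by positivity)]
    linarith
  calc Real.log ((n : ℝ) + 1) ≤ Real.sqrt ((n : ℝ) + 1) / (1 / 2) := h1
    _ = 2 * Real.sqrt ((n : ℝ) + 1) := by ring
    _ ≤ 2 * (2 * Real.sqrt n) := by gcongr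
    _ = 4 * Real.sqrt n := by ring

/-- (E1) polynomial ≪ exponential of `√n`: `(n+1)^{3/2} ≤ e^{(3C₀/4)√n}` eventually. -/
theorem eventually_E1 (C₀ : ℝ) (hC₀ : 0 < C₀) :
    ∃ N : ℕ, ∀ n ≥ N, ((n : ℝ) + 1) * Real.sqrt ((n : ℝ) + 1) ≤
      Real.exp ((3 * C₀ / 4) * Real.sqrt n) := by
  set κ : ℝ := (3 * C₀ / 4) ^ 6 / 720 with hκ
  have hκ0 : 0 < κ := by positivity
  refine ⟨⌈4 / κ⌉₊ + 1, fun n hn => ?_⟩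
  have hn1' : 1 ≤ n := le_trans (Nat.le_add_left 1 _) hn
  have hn1 : (1 : ℝ) ≤ n := by exact_mod_cast hn1'
  have hn0 : (0 : ℝ) ≤ n := by positivity
  have hκn : 4 ≤ κ * n := by
    have : (4 / κ : ℝ) ≤ n := by
      have h1 : (4 / κ : ℝ) ≤ ⌈4 / κ⌉₊ := Nat.le_ceil _
      have h2 : ((⌈4 / κ⌉₊ : ℕ) : ℝ) ≤ n := by exact_mod_cast (Nat.le_succ _).trans hn
      exact h1.trans h2
    rwa [div_le_iff₀ hκ0, mul_comm] at this
  set s : ℝ := Real.sqrt n with hs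
  have hs0 : 0 ≤ s := Real.sqrt_nonneg _
  have hs2 : s ^ 2 = n := Real.sq_sqrt hn0
  have hx0 : 0 ≤ 3 * C₀ / 4 * s := by positivity
  have hexp := Real.pow_div_factorial_le_exp (3 * C₀ / 4 * s) hx0 6
  have h720 : ((Nat.factorial 6 : ℕ) : ℝ) = 720 := by norm_num [Nat.factorial]
  have hx6 : (3 * C₀ / 4 * s) ^ 6 / ((Nat.factorial 6 : ℕ) : ℝ) = κ * (n : ℝ) ^ 3 := by
    rw [h720, hκ, mul_pow, show s ^ 6 = (s ^ 2) ^ 3 by ring, hs2]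
    ring
  have hsq : Real.sqrt ((n : ℝ) + 1) ≤ (n : ℝ) + 1 := by
    rw [Real.sqrt_le_iff]
    exact ⟨by positivity, by nlinarith⟩
  calc ((n : ℝ) + 1) * Real.sqrt ((n : ℝ) + 1) ≤ ((n : ℝ) + 1) * ((n : ℝ) + 1) := by gcongr
    _ ≤ 4 * (n : ℝ) ^ 2 := by nlinarith
    _ ≤ κ * n * (n : ℝ) ^ 2 := by gcongr
    _ = κ * (n : ℝ) ^ 3 := by ring
    _ = (3 * C₀ / 4 * s) ^ 6 / ((Nat.factorial 6 : ℕ) : ℝ) := hx6.symm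
    _ ≤ Real.exp (3 * C₀ / 4 * s) := hexp

/-- (E2) `e^{O(√n log n)} ≤ √(n!)` eventually (Stirling). -/
theorem eventually_E2 (lam CL c : ℝ) (B : ℕ) (hlam : 1 < lam) :
    ∃ N : ℕ, ∀ n ≥ N,
      2 * Real.exp (CL * Real.sqrt n) * Real.exp (c * Real.sqrt n) *
          (n : ℝ) ^ (14 / Real.log lam * Real.sqrt n) *
          (((n : ℝ) + 1) * Real.sqrt ((n : ℝ) + 1)) ^ B * Real.exp (c * Real.sqrt n) ^ B ≤
        Real.sqrt (n.factorial : ℝ) := by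
  have hlog : 0 < Real.log lam := Real.log_pos hlam
  set q : ℝ := 14 / Real.log lam with hq
  have hq0 : 0 ≤ q := by positivity
  obtain ⟨D, hD⟩ : ∃ D : ℝ, D = Real.log 2 + |CL| + |c| + q + 6 * B + B * |c| := ⟨_, rfl⟩
  have hlog2 : 0 ≤ Real.log 2 := Real.log_nonneg (by norm_num)
  have hD0 : 0 ≤ D := by rw [hD]; positivity
  refine ⟨max ⌈Real.exp 2⌉₊ ⌈64 * D ^ 2⌉₊, fun n hn => ?_⟩
  have hn_exp : Real.exp 2 ≤ n := by
    have h1 : Real.exp 2 ≤ ⌈Real.exp 2⌉₊ := Nat.le_ceil _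
    have h2 : ((⌈Real.exp 2⌉₊ : ℕ) : ℝ) ≤ n := by exact_mod_cast (le_max_left _ _).trans hn
    exact h1.trans h2
  have hn_D : 64 * D ^ 2 ≤ n := by
    have h1 : 64 * D ^ 2 ≤ ⌈64 * D ^ 2⌉₊ := Nat.le_ceil _
    have h2 : ((⌈64 * D ^ 2⌉₊ : ℕ) : ℝ) ≤ n := by exact_mod_cast (le_max_right _ _).trans hn
    exact h1.trans h2
  have hnpos : (0 : ℝ) < n := (Real.exp_pos 2).trans_le hn_exp
  have hn1 : (1 : ℝ) ≤ n := by
    have : (1 : ℝ) ≤ Real.exp 2 := Real.one_le_exp (by norm_num)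
    exact this.trans hn_exp
  have hlogn2 : 2 ≤ Real.log n := by
    rw [Real.le_log_iff_exp_le hnpos]
    exact hn_exp
  have hlogn0 : 0 ≤ Real.log n := by linarith
  set s : ℝ := Real.sqrt n with hs
  have hs1 : 1 ≤ s := by
    rw [hs, ← Real.sqrt_one]
    exact Real.sqrt_le_sqrt hn1
  have hs0 : 0 ≤ s := by linarith
  have hss : s * s = n := Real.mul_self_sqrt hnpos.le
  have hs8D : 8 * D ≤ s := by
    rw [hs, Real.le_sqrt (by linarith) hnpos.le]
    nlinarith
  -- the factor (n+1)√(n+1) ≤ exp(6 s)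
  have hn_nat1 : 1 ≤ n := by exact_mod_cast hn1
  have hlog1 : Real.log ((n : ℝ) + 1) ≤ 4 * s := log_succ_le_four_sqrt n hn_nat1
  have hY0 : 0 < ((n : ℝ) + 1) * Real.sqrt ((n : ℝ) + 1) := by positivity
  have hY : ((n : ℝ) + 1) * Real.sqrt ((n : ℝ) + 1) ≤ Real.exp (6 * s) := by
    rw [← Real.exp_log hY0, Real.exp_le_exp, Real.log_mul (by positivity) (by positivity),
      Real.log_sqrt (by positivity)]
    linarith
  -- the factor n^{q s} = exp(q s log n)
  have hnq : (n : ℝ) ^ (q * s) = Real.exp (q * s * Real.log n) := by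
    rw [Real.rpow_def_of_pos hnpos]
    ring_nf
  -- assemble an exponential upper bound
  have hbound : 2 * Real.exp (CL * s) * Real.exp (c * s) * (n : ℝ) ^ (q * s) *
        (((n : ℝ) + 1) * Real.sqrt ((n : ℝ) + 1)) ^ B * Real.exp (c * s) ^ B ≤
      Real.exp (Real.log 2 + |CL| * s + |c| * s + q * s * Real.log n + B * (6 * s) + B * (|c| * s)) := by
    have e2 : (2 : ℝ) = Real.exp (Real.log 2) := (Real.exp_log (by norm_num)).symm
    have eCL : Real.exp (CL * s) ≤ Real.exp (|CL| * s) := by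
      rw [Real.exp_le_exp]; exact mul_le_mul_of_nonneg_right (le_abs_self _) hs0
    have ec : Real.exp (c * s) ≤ Real.exp (|c| * s) := by
      rw [Real.exp_le_exp]; exact mul_le_mul_of_nonneg_right (le_abs_self _) hs0
    have eY : (((n : ℝ) + 1) * Real.sqrt ((n : ℝ) + 1)) ^ B ≤ Real.exp (B * (6 * s)) := by
      rw [Real.exp_nat_mul]
      exact pow_le_pow_left₀ hY0.le hY B
    have ecB : Real.exp (c * s) ^ B ≤ Real.exp (B * (|c| * s)) := by
      rw [Real.exp_nat_mul]
      exact pow_le_pow_left₀ (Real.exp_pos _).le ec B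
    calc 2 * Real.exp (CL * s) * Real.exp (c * s) * (n : ℝ) ^ (q * s) *
          (((n : ℝ) + 1) * Real.sqrt ((n : ℝ) + 1)) ^ B * Real.exp (c * s) ^ B
        ≤ Real.exp (Real.log 2) * Real.exp (|CL| * s) * Real.exp (|c| * s) *
            Real.exp (q * s * Real.log n) * Real.exp (B * (6 * s)) * Real.exp (B * (|c| * s)) := by
          rw [← e2, hnq]
          gcongr
      _ = Real.exp (Real.log 2 + |CL| * s + |c| * s + q * s * Real.log n + B * (6 * s) +
            B * (|c| * s)) := by
          simp only [Real.exp_add]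
  -- compare exponents with log √(n!) via Stirling
  have hexpo : Real.log 2 + |CL| * s + |c| * s + q * s * Real.log n + B * (6 * s) + B * (|c| * s) ≤
      Real.log (Real.sqrt (n.factorial : ℝ)) := by
    have hfac0 : (0 : ℝ) < (n.factorial : ℝ) := by exact_mod_cast n.factorial_pos
    rw [Real.log_sqrt hfac0.le]
    have hst := Stirling.le_log_factorial_stirling (n := n) (by exact_mod_cast (show n ≠ 0 by omega))
    have hpi : 0 ≤ Real.log (2 * Real.pi) / 2 := by
      have : (1 : ℝ) ≤ 2 * Real.pi := by linarith [Real.pi_gt_three]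
      have := Real.log_nonneg this
      linarith
    -- each term ≤ coefficient * s * (1 + log n), and s * (1 + log n) ≥ 1
    obtain ⟨W, hW⟩ : ∃ W : ℝ, W = s * (1 + Real.log n) := ⟨_, rfl⟩
    have hW1 : 1 ≤ W := by rw [hW]; nlinarith
    have hsW : s ≤ W := by rw [hW]; exact le_mul_of_one_le_right hs0 (by linarith)
    have hW0 : 0 ≤ W := by linarith
    have hB0 : (0 : ℝ) ≤ B := Nat.cast_nonneg _
    have habsCL : 0 ≤ |CL| := abs_nonneg _
    have habsc : 0 ≤ |c| := abs_nonneg _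
    have t0 : Real.log 2 ≤ Real.log 2 * W := le_mul_of_one_le_right hlog2 hW1
    have t1 : |CL| * s ≤ |CL| * W := mul_le_mul_of_nonneg_left hsW habsCL
    have t2 : |c| * s ≤ |c| * W := mul_le_mul_of_nonneg_left hsW habsc
    have t3 : q * s * Real.log n ≤ q * W := by
      rw [hW, ← mul_assoc]
      exact mul_le_mul_of_nonneg_left (by linarith) (mul_nonneg hq0 hs0)
    have t4 : (B : ℝ) * (6 * s) ≤ 6 * B * W := by
      have := mul_le_mul_of_nonneg_left hsW hB0
      linarith
    have t5 : (B : ℝ) * (|c| * s) ≤ B * |c| * W := by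
      have := mul_le_mul_of_nonneg_left hsW (mul_nonneg hB0 habsc)
      linarith
    have hsum : Real.log 2 + |CL| * s + |c| * s + q * s * Real.log n + B * (6 * s) + B * (|c| * s) ≤
        D * W := by
      calc Real.log 2 + |CL| * s + |c| * s + q * s * Real.log n + B * (6 * s) + B * (|c| * s)
          ≤ Real.log 2 * W + |CL| * W + |c| * W + q * W + 6 * B * W + B * |c| * W := by linarith
        _ = D * W := by rw [hD]; ring
    have h2 : D * W ≤ 2 * D * s * Real.log n := by
      have : W ≤ s * (2 * Real.log n) := by
        rw [hW]; exact mul_le_mul_of_nonneg_left (by linarith) hs0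
      calc D * W ≤ D * (s * (2 * Real.log n)) := mul_le_mul_of_nonneg_left this hD0
        _ = 2 * D * s * Real.log n := by ring
    have h3 : 2 * D * s * Real.log n ≤ (n : ℝ) / 4 * Real.log n := by
      have h8 : 8 * D * s ≤ s * s := mul_le_mul_of_nonneg_right hs8D hs0
      have : 2 * D * s ≤ (n : ℝ) / 4 := by rw [← hss]; linarith
      exact mul_le_mul_of_nonneg_right this hlogn0
    have h4 : (n : ℝ) / 4 * Real.log n ≤ (n * Real.log n - n) / 2 := by
      have hnl : (n : ℝ) * 2 ≤ n * Real.log n := mul_le_mul_of_nonneg_left hlogn2 hnpos.le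
      have e : (n : ℝ) / 4 * Real.log n = (n * Real.log n) / 4 := by ring
      rw [e]; linarith
    linarith
  have hfacpos : 0 < Real.sqrt (n.factorial : ℝ) := Real.sqrt_pos.mpr (by exact_mod_cast n.factorial_pos)
  calc _ ≤ Real.exp (Real.log 2 + |CL| * s + |c| * s + q * s * Real.log n + B * (6 * s) + B * (|c| * s)) :=
        hbound
    _ ≤ Real.exp (Real.log (Real.sqrt (n.factorial : ℝ))) := Real.exp_le_exp.mpr hexpo
    _ = Real.sqrt (n.factorial : ℝ) := Real.exp_log hfacpos

/-! ### The per-`n` estimate and the composition -/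

set_option maxHeartbeats 800000 in
/-- The whole argument at one fixed large `n`, with the two asymptotic stubs already specialised:
a hosted TPP triple in three fpf-involution centralisers has `∏|X i|·e^{c√n} ≤ n!·√(n!)`. -/
theorem main_estimate (lam : ℝ) (hlam : 1 < lam) (B : ℕ) (hB : 1 ≤ B) (CL C₀ c : ℝ)
    (hc : 0 < c) (hcC : c ≤ C₀ / 4) (hc2 : c ≤ 1 / 2)
    (n : ℕ) (hn : 1 ≤ n)
    (hHT : ∀ μ : Fin 3 → Equiv.Perm (Fin n), (∀ i, μ i * μ i = 1) →
      (∀ i, (fixCard n (μ i) : ℝ) ≤ 14 / Real.log lam * Real.sqrt n) →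
      (∀ i j, i ≠ j → (interCard n (μ i) (μ j) : ℝ) ≤ Real.exp (C₀ * Real.sqrt n)) →
      (∏ i, ((hostSet n (μ i)).card : ℝ)) ≤ 2 * (n.factorial : ℝ) * (triN n μ : ℝ))
    (hRC : ∀ μ : Fin 3 → Equiv.Perm (Fin n), ∀ X : Fin 3 → Finset (Equiv.Perm (Fin n)),
      (∀ i, μ i * μ i = 1) → (∀ i, ∀ σ ∈ X i, σ * μ i = μ i * σ ∧ ∀ x, μ i x = x → σ x = x) →
      (∀ i, (X i).Nonempty) → (∀ i, (fixCard n (μ i) : ℝ) ≤ 14 / Real.log lam * Real.sqrt n) →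
      ((∏ i, ((hostSet n (μ i)).card : ℝ)) ≤ Real.exp (7 * Real.sqrt n) * ∏ i, ((X i).card : ℝ)) →
      (∀ i j, i ≠ j → (interCard n (μ i) (μ j) : ℝ) ≤ Real.exp (C₀ * Real.sqrt n)) →
      (∀ i, ∀ (t : ℕ) (a b : Fin t → Fin n), Function.Injective a →
        (((X i).filter (fun σ => ∀ k, σ (a k) = b k)).card : ℝ) * (hostSet n (μ i)).card ≤
          lam ^ t * (X i).card *
            (univ.filter (fun σ : Equiv.Perm (Fin n) =>
              (σ * μ i = μ i * σ ∧ ∀ x, μ i x = x → σ x = x) ∧ ∀ k, σ (a k) = b k)).card) →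
      (∏ i, ((X i).card : ℝ)) ^ (B + 1) * (triN n μ : ℝ) * (∏ i, ((hostSet n (μ i)).card : ℝ)) ≤
        (sexN n X : ℝ) * (∏ i, ((hostSet n (μ i)).card : ℝ)) ^ (B + 1) *
          Real.exp (CL * Real.sqrt n))
    (hE1 : ((n : ℝ) + 1) * Real.sqrt ((n : ℝ) + 1) ≤ Real.exp ((3 * C₀ / 4) * Real.sqrt n))
    (hE2 : 2 * Real.exp (CL * Real.sqrt n) * Real.exp (c * Real.sqrt n) *
        (n : ℝ) ^ (14 / Real.log lam * Real.sqrt n) *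
        (((n : ℝ) + 1) * Real.sqrt ((n : ℝ) + 1)) ^ B * Real.exp (c * Real.sqrt n) ^ B ≤
        Real.sqrt (n.factorial : ℝ))
    (μ : Fin 3 → Equiv.Perm (Fin n)) (hμ : ∀ i, μ i * μ i = 1 ∧ ∀ x, μ i x ≠ x)
    (X : Fin 3 → Finset (Equiv.Perm (Fin n))) (hX : ∀ i, ∀ σ ∈ X i, σ * μ i = μ i * σ)
    (hT : TripleProductProperty (X 0) (X 1) (X 2)) :
    (∏ i, ((X i).card : ℝ)) * Real.exp (c * Real.sqrt n) ≤
      (n.factorial : ℝ) * Real.sqrt (n.factorial : ℝ) := by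
  -- scalars
  have hF0 : (0 : ℝ) < (n.factorial : ℝ) := by exact_mod_cast n.factorial_pos
  have hn1 : (1 : ℝ) ≤ n := by exact_mod_cast hn
  have hs1 : 1 ≤ Real.sqrt n := by rw [← Real.sqrt_one]; exact Real.sqrt_le_sqrt hn1
  have hs0 : 0 ≤ Real.sqrt n := Real.sqrt_nonneg _
  have hE0 : 0 < Real.exp (c * Real.sqrt n) := Real.exp_pos _
  have hlog : 0 < Real.log lam := Real.log_pos hlam
  have hq0 : 0 ≤ 14 / Real.log lam := by positivity
  have hG0 : 0 < (n.factorial : ℝ) * Real.sqrt (n.factorial : ℝ) := by positivity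
  have hY0 : 0 < ((n : ℝ) + 1) * Real.sqrt ((n : ℝ) + 1) := by positivity
  -- abbreviate the scalars by opaque names
  generalize hs : Real.sqrt (n : ℝ) = s at *
  generalize hF : (n.factorial : ℝ) = F at *
  generalize hE : Real.exp (c * s) = E at *
  generalize hq : 14 / Real.log lam = q at *
  generalize hG : F * Real.sqrt F = G at *
  generalize hY : ((n : ℝ) + 1) * Real.sqrt ((n : ℝ) + 1) = Y at *
  -- empty case
  by_cases hne : ∀ i, (X i).Nonempty
  swap
  · push Not at hne
    obtain ⟨i, hi⟩ := hne
    have hP0 : (∏ i, ((X i).card : ℝ)) = 0 :=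
      Finset.prod_eq_zero (Finset.mem_univ i) (by simp [hi])
    rw [hP0, zero_mul]
    exact hG0.le
  -- hosted form of the hypotheses
  have hXh : ∀ i, ∀ σ ∈ X i, σ * μ i = μ i * σ ∧ ∀ x, μ i x = x → σ x = x :=
    fun i σ hσ => ⟨hX i σ hσ, fun x hx => absurd hx ((hμ i).2 x)⟩
  have hμ1 : ∀ i, μ i * μ i = 1 := fun i => (hμ i).1
  -- argue by contradiction
  by_contra hcon
  have hGP : G < (∏ i, ((X i).card : ℝ)) * E := lt_of_not_ge hcon
  -- saturate (junta half) and the elementary stubs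
  obtain ⟨μ', X', hμ', hX'h, hne', hT', hglob, hmono, hbudget, hcost⟩ :=
    saturate' lam hlam n μ X hμ1 hXh hne hT
  obtain ⟨-, hpk2⟩ := packing' n μ X hμ1 hXh hT
  obtain ⟨hpk1, -⟩ := packing' n μ' X' hμ' hX'h hT'
  have hS6 := sextuple_card_le n X' hT'
  -- subsets, positivity
  have hsub : ∀ i, X i ⊆ hostSet n (μ i) := fun i => subset_hostSet _ _ (hXh i)
  have hsub' : ∀ i, X' i ⊆ hostSet n (μ' i) := fun i => subset_hostSet _ _ (hX'h i)
  have hXpos : ∀ i, (0 : ℝ) < (X i).card := fun i => by exact_mod_cast (hne i).card_pos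
  have hX'pos : ∀ i, (0 : ℝ) < (X' i).card := fun i => by exact_mod_cast (hne' i).card_pos
  have hXleK : ∀ i, ((X i).card : ℝ) ≤ (hostSet n (μ i)).card := fun i => by
    exact_mod_cast Finset.card_le_card (hsub i)
  have hX'leK : ∀ i, ((X' i).card : ℝ) ≤ (hostSet n (μ' i)).card := fun i => by
    exact_mod_cast Finset.card_le_card (hsub' i)
  have hK'0 : ∀ i, (0 : ℝ) ≤ (hostSet n (μ' i)).card := fun i => Nat.cast_nonneg _
  have hP0 : 0 < ∏ i, ((X i).card : ℝ) := Finset.prod_pos (fun i _ => hXpos i)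
  have hPf0 : 0 < ∏ i, ((X' i).card : ℝ) := Finset.prod_pos (fun i _ => hX'pos i)
  have hPleKp : (∏ i, ((X i).card : ℝ)) ≤ ∏ i, ((hostSet n (μ i)).card : ℝ) :=
    Finset.prod_le_prod (fun i _ => (hXpos i).le) (fun i _ => hXleK i)
  have hPfleKf : (∏ i, ((X' i).card : ℝ)) ≤ ∏ i, ((hostSet n (μ' i)).card : ℝ) :=
    Finset.prod_le_prod (fun i _ => (hX'pos i).le) (fun i _ => hX'leK i)
  -- the original hosts are fpf: no fixed points
  have hfix0 : (∑ i, fixCard n (μ i)) = 0 :=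
    Finset.sum_eq_zero (fun i _ => fixCard_eq_zero _ (hμ i).2)
  rw [hfix0, pow_zero, one_mul] at hbudget
  -- host sizes: (∏|K|)² ≤ ((n+1) F)³  (packing (ii))
  have hKp2 : (∏ i, ((hostSet n (μ i)).card : ℝ)) ^ 2 ≤ (((n : ℝ) + 1) * F) ^ 3 := by
    rw [← Finset.prod_pow]
    calc ∏ i, ((hostSet n (μ i)).card : ℝ) ^ 2 ≤ ∏ _i : Fin 3, (((n : ℝ) + 1) * F) :=
          Finset.prod_le_prod (fun i _ => by positivity) (fun i _ => by
            have h := hpk2 i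
            push_cast at h
            rw [← hF]
            exact h)
      _ = (((n : ℝ) + 1) * F) ^ 3 := by simp [Finset.prod_const]
  -- the fixed-point budget, cast to ℝ
  have hfix'sum : ∀ i, (fixCard n (μ' i) : ℝ) ≤ ((∑ i, fixCard n (μ' i) : ℕ) : ℝ) := fun i => by
    exact_mod_cast Finset.single_le_sum (f := fun i => fixCard n (μ' i)) (fun i _ => Nat.zero_le _)
      (Finset.mem_univ i)
  -- opaque names for the four products and the budget
  generalize hP : (∏ i, ((X i).card : ℝ)) = P at *
  generalize hPf : (∏ i, ((X' i).card : ℝ)) = Pf at *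
  generalize hKp : (∏ i, ((hostSet n (μ i)).card : ℝ)) = Kp at *
  generalize hKf : (∏ i, ((hostSet n (μ' i)).card : ℝ)) = Kf at *
  generalize hF' : (∑ i, fixCard n (μ' i)) = F' at *
  have hKp0 : 0 < Kp := hP0.trans_le hPleKp
  have hKf0 : 0 < Kf := hPf0.trans_le hPfleKf
  -- Kp ≤ Y * G
  have hYG : (Y * G) ^ 2 = (((n : ℝ) + 1) * F) ^ 3 := by
    rw [← hY, ← hG, mul_pow, mul_pow, mul_pow, Real.sq_sqrt (by positivity), Real.sq_sqrt hF0.le]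
    ring
  have hYG0 : 0 ≤ Y * G := by positivity
  have hKpH : Kp ≤ Y * G :=
    (pow_le_pow_iff_left₀ hKp0.le hYG0 two_ne_zero).mp (by rw [hYG]; exact hKp2)
  -- root budget: F' ≤ q s
  have hlampos : 0 < lam ^ F' := pow_pos (by linarith) _
  have hlamF' : lam ^ F' < Y ^ 2 * E ^ 2 := by
    have h1 : lam ^ F' * P ^ 2 ≤ (Y * G) ^ 2 :=
      hbudget.trans (pow_le_pow_left₀ hKp0.le hKpH 2)
    have h2 : (Y * G) ^ 2 < (Y * (P * E)) ^ 2 := by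
      have : Y * G < Y * (P * E) := mul_lt_mul_of_pos_left hGP hY0
      exact pow_lt_pow_left₀ this hYG0 two_ne_zero
    have h3 : lam ^ F' * P ^ 2 < (Y ^ 2 * E ^ 2) * P ^ 2 := by
      calc lam ^ F' * P ^ 2 < (Y * (P * E)) ^ 2 := h1.trans_lt h2
        _ = (Y ^ 2 * E ^ 2) * P ^ 2 := by ring
    exact lt_of_mul_lt_mul_right h3 (sq_nonneg P)
  have hlog1 : Real.log ((n : ℝ) + 1) ≤ 4 * s := hs ▸ log_succ_le_four_sqrt n hn
  have hlogY : Real.log Y ≤ 6 * s := by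
    rw [← hY, Real.log_mul (by positivity) (by positivity), Real.log_sqrt (by positivity)]
    linarith
  have hF'bound : (F' : ℝ) * Real.log lam < 2 * Real.log Y + 2 * (c * s) := by
    have h := Real.log_lt_log hlampos hlamF'
    rw [Real.log_pow, Real.log_mul (pow_pos hY0 2).ne' (pow_pos hE0 2).ne', Real.log_pow,
      Real.log_pow, ← hE, Real.log_exp] at h
    push_cast at h
    linarith
  have hF'le : (F' : ℝ) ≤ q * s := by
    have h1 : (F' : ℝ) * Real.log lam ≤ 13 * s := by nlinarith
    rw [← hq, div_mul_eq_mul_div, le_div_iff₀ hlog]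
    linarith
  have hfix' : ∀ i, (fixCard n (μ' i) : ℝ) ≤ q * s := fun i => (hfix'sum i).trans hF'le
  -- P ≤ r Kp with r = Pf / Kf
  obtain ⟨r, hr⟩ : ∃ r : ℝ, r = Pf / Kf := ⟨_, rfl⟩
  have hr0 : 0 < r := by rw [hr]; exact div_pos hPf0 hKf0
  have hPfr : Pf = r * Kf := by rw [hr, div_mul_cancel₀ _ hKf0.ne']
  have hPle : P ≤ r * Kp := by
    have h1 : P * Kf ≤ r * Kp * Kf := by
      calc P * Kf ≤ Pf * Kp := hmono
        _ = r * Kp * Kf := by rw [hPfr]; ring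
    exact le_of_mul_le_mul_right h1 hKf0
  -- regime split on the final hosts
  by_cases hz : ∀ i j, i ≠ j → (interCard n (μ' i) (μ' j) : ℝ) ≤ Real.exp (C₀ * s)
  · -- COUNTING REGIME
    have hN : Kf ≤ 2 * F * (triN n μ' : ℝ) := by
      have h := hHT μ' hμ' hfix' hz
      rw [hKf] at h
      exact h
    -- density floor of the refined triple: Kf ≤ e^{7 s} Pf
    have hY6 : Y ≤ Real.exp (6 * s) := by
      rw [← Real.exp_log hY0]
      exact Real.exp_le_exp.mpr hlogY
    have hEs : E ≤ Real.exp s := by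
      rw [← hE, Real.exp_le_exp]
      have h1 : c * s ≤ 1 * s := mul_le_mul_of_nonneg_right (by linarith) hs0
      linarith
    have hdens : Kf ≤ Real.exp (7 * s) * Pf := by
      have h1 : P * Kf < P * (Pf * Y * E) := by
        calc P * Kf ≤ Pf * Kp := hmono
          _ ≤ Pf * (Y * G) := mul_le_mul_of_nonneg_left hKpH hPf0.le
          _ < Pf * (Y * (P * E)) := mul_lt_mul_of_pos_left (mul_lt_mul_of_pos_left hGP hY0) hPf0
          _ = P * (Pf * Y * E) := by ring
      have h2 : Kf < Pf * Y * E := lt_of_mul_lt_mul_left h1 hP0.le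
      have h3 : Pf * Y * E ≤ Pf * Real.exp (6 * s) * Real.exp s :=
        mul_le_mul (mul_le_mul_of_nonneg_left hY6 hPf0.le) hEs hE0.le (by positivity)
      have h4 : Pf * Real.exp (6 * s) * Real.exp s = Real.exp (7 * s) * Pf := by
        rw [mul_assoc, ← Real.exp_add]
        ring_nf
      linarith
    have hR : Pf ^ (B + 1) * (triN n μ' : ℝ) * Kf ≤
        (sexN n X' : ℝ) * Kf ^ (B + 1) * Real.exp (CL * s) := by
      have h := hRC μ' X' hμ' hX'h hne' hfix'
      rw [hPf, hKf] at h
      exact h hdens hz hglob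
    have hN'0 : (0 : ℝ) ≤ (triN n μ' : ℝ) := Nat.cast_nonneg _
    have hexpCL : 0 ≤ Real.exp (CL * s) := (Real.exp_pos _).le
    have hPfB0 : 0 ≤ Pf ^ (B + 1) := pow_nonneg hPf0.le _
    have hKfB0 : 0 ≤ Kf ^ (B + 1) := pow_nonneg hKf0.le _
    have hstar : Pf ^ (B + 1) * Kf ^ 2 ≤ 2 * F * Real.exp (CL * s) * Pf * Kf ^ (B + 1) := by
      calc Pf ^ (B + 1) * Kf ^ 2 = Pf ^ (B + 1) * Kf * Kf := by ring
        _ ≤ Pf ^ (B + 1) * Kf * (2 * F * (triN n μ' : ℝ)) :=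
            mul_le_mul_of_nonneg_left hN (mul_nonneg hPfB0 hKf0.le)
        _ = 2 * F * (Pf ^ (B + 1) * (triN n μ' : ℝ) * Kf) := by ring
        _ ≤ 2 * F * ((sexN n X' : ℝ) * Kf ^ (B + 1) * Real.exp (CL * s)) :=
            mul_le_mul_of_nonneg_left hR (by positivity)
        _ ≤ 2 * F * (Pf * Kf ^ (B + 1) * Real.exp (CL * s)) := by
            apply mul_le_mul_of_nonneg_left _ (by positivity)
            exact mul_le_mul_of_nonneg_right (mul_le_mul_of_nonneg_right hS6 hKfB0) hexpCL
        _ = 2 * F * Real.exp (CL * s) * Pf * Kf ^ (B + 1) := by ring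
    have hrB : r ^ B * Kf ≤ 2 * F * Real.exp (CL * s) := by
      rw [hPfr] at hstar
      have hpos : 0 < r * Kf ^ (B + 2) := mul_pos hr0 (pow_pos hKf0 _)
      refine le_of_mul_le_mul_left ?_ hpos
      calc r * Kf ^ (B + 2) * (r ^ B * Kf) = (r * Kf) ^ (B + 1) * Kf ^ 2 := by ring
        _ ≤ 2 * F * Real.exp (CL * s) * (r * Kf) * Kf ^ (B + 1) := hstar
        _ = r * Kf ^ (B + 2) * (2 * F * Real.exp (CL * s)) := by ring
    -- lower bound on Kf:  G < n^{q s} · Kf · E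
    have hnF' : (n : ℝ) ^ F' ≤ (n : ℝ) ^ (q * s) := by
      rw [← Real.rpow_natCast]
      exact Real.rpow_le_rpow_of_exponent_le hn1 hF'le
    have hnq0 : (0 : ℝ) ≤ (n : ℝ) ^ (q * s) := by positivity
    have hnF'0 : (0 : ℝ) ≤ (n : ℝ) ^ F' := by positivity
    have hGKf : G < (n : ℝ) ^ (q * s) * Kf * E := by
      calc G < P * E := hGP
        _ ≤ Kp * E := mul_le_mul_of_nonneg_right hPleKp hE0.le
        _ ≤ (n : ℝ) ^ F' * Kf * E := mul_le_mul_of_nonneg_right hcost hE0.le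
        _ ≤ (n : ℝ) ^ (q * s) * Kf * E :=
            mul_le_mul_of_nonneg_right (mul_le_mul_of_nonneg_right hnF' hKf0.le) hE0.le
    have hrBG : r ^ B * G < (n : ℝ) ^ (q * s) * E * (2 * F * Real.exp (CL * s)) := by
      have hrBpos : 0 < r ^ B := pow_pos hr0 _
      calc r ^ B * G < r ^ B * ((n : ℝ) ^ (q * s) * Kf * E) := mul_lt_mul_of_pos_left hGKf hrBpos
        _ = (n : ℝ) ^ (q * s) * E * (r ^ B * Kf) := by ring
        _ ≤ (n : ℝ) ^ (q * s) * E * (2 * F * Real.exp (CL * s)) :=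
            mul_le_mul_of_nonneg_left hrB (mul_nonneg hnq0 hE0.le)
    -- hence r ≤ 1/(Y E), else contradiction with (E2)
    have hYE0 : 0 < Y * E := mul_pos hY0 hE0
    have hrle : r ≤ (Y * E)⁻¹ := by
      by_contra hlt
      have hlt' : (Y * E)⁻¹ < r := lt_of_not_ge hlt
      have h1 : ((Y * E)⁻¹) ^ B < r ^ B :=
        pow_lt_pow_left₀ hlt' (inv_nonneg.mpr hYE0.le) (by omega)
      have h2 : ((Y * E)⁻¹) ^ B * G < (n : ℝ) ^ (q * s) * E * (2 * F * Real.exp (CL * s)) :=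
        lt_of_le_of_lt (mul_le_mul_of_nonneg_right h1.le hG0.le) hrBG
      have h3 : G < (Y * E) ^ B * ((n : ℝ) ^ (q * s) * E * (2 * F * Real.exp (CL * s))) := by
        have h4 := mul_lt_mul_of_pos_left h2 (pow_pos hYE0 B)
        calc G = (Y * E) ^ B * (((Y * E)⁻¹) ^ B * G) := by
              rw [inv_pow, ← mul_assoc, mul_inv_cancel₀ (pow_ne_zero _ hYE0.ne'), one_mul]
          _ < _ := h4
      have h5 : Real.sqrt F < 2 * Real.exp (CL * s) * E * (n : ℝ) ^ (q * s) * Y ^ B * E ^ B := by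
        have h6 : G = Real.sqrt F * F := by rw [← hG]; ring
        have h7 : (Y * E) ^ B * ((n : ℝ) ^ (q * s) * E * (2 * F * Real.exp (CL * s))) =
            (2 * Real.exp (CL * s) * E * (n : ℝ) ^ (q * s) * Y ^ B * E ^ B) * F := by ring
        rw [h6, h7] at h3
        exact lt_of_mul_lt_mul_right h3 hF0.le
      linarith [h5, hE2]
    -- finish: P E ≤ r Kp E ≤ r Y G E ≤ (Y E)⁻¹ Y G E = G
    have hfin : P * E ≤ G := by
      calc P * E ≤ r * Kp * E := mul_le_mul_of_nonneg_right hPle hE0.le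
        _ ≤ r * (Y * G) * E :=
            mul_le_mul_of_nonneg_right (mul_le_mul_of_nonneg_left hKpH hr0.le) hE0.le
        _ ≤ (Y * E)⁻¹ * (Y * G) * E :=
            mul_le_mul_of_nonneg_right (mul_le_mul_of_nonneg_right hrle hYG0) hE0.le
        _ = (Y * E)⁻¹ * (Y * E) * G := by ring
        _ = G := by rw [inv_mul_cancel₀ hYE0.ne', one_mul]
    exact hcon hfin
  · -- PACKING REGIME
    push Not at hz
    obtain ⟨i, j, hij, hzij⟩ := hz
    have h1 := hpk1 i j hij
    obtain ⟨k, hk⟩ := prod_three_split i j hij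
    have hPf3 : Pf = (X' i).card * (X' j).card * (X' k).card := by rw [← hPf]; exact hk _
    have hKf3 : Kf = (hostSet n (μ' i)).card * (hostSet n (μ' j)).card *
        (hostSet n (μ' k)).card := by rw [← hKf]; exact hk _
    have hexp0 : 0 < Real.exp (C₀ * s) := Real.exp_pos _
    have h2 : ((X' i).card : ℝ) * (X' j).card * Real.exp (C₀ * s) <
        (hostSet n (μ' i)).card * (hostSet n (μ' j)).card := by
      have hxx : (0 : ℝ) < (X' i).card * (X' j).card := mul_pos (hX'pos i) (hX'pos j)
      calc ((X' i).card : ℝ) * (X' j).card * Real.exp (C₀ * s)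
          < (X' i).card * (X' j).card * (interCard n (μ' i) (μ' j) : ℝ) :=
            mul_lt_mul_of_pos_left hzij hxx
        _ ≤ _ := h1
    have hPfKf : Pf * Real.exp (C₀ * s) < Kf := by
      rw [hPf3, hKf3]
      calc ((X' i).card : ℝ) * (X' j).card * (X' k).card * Real.exp (C₀ * s)
          = ((X' i).card * (X' j).card * Real.exp (C₀ * s)) * (X' k).card := by ring
        _ < ((hostSet n (μ' i)).card * (hostSet n (μ' j)).card) * (X' k).card :=
            mul_lt_mul_of_pos_right h2 (hX'pos k)
        _ ≤ ((hostSet n (μ' i)).card * (hostSet n (μ' j)).card) * (hostSet n (μ' k)).card :=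
            mul_le_mul_of_nonneg_left (hX'leK k) (mul_nonneg (hK'0 i) (hK'0 j))
    -- P·e^{C₀ s} < Kp ≤ Y G ≤ e^{3C₀ s/4} G
    have hPexp : P * Real.exp (C₀ * s) < Y * G := by
      have h3 : P * Real.exp (C₀ * s) * Kf ≤ Pf * Real.exp (C₀ * s) * Kp := by
        calc P * Real.exp (C₀ * s) * Kf = (P * Kf) * Real.exp (C₀ * s) := by ring
          _ ≤ (Pf * Kp) * Real.exp (C₀ * s) := mul_le_mul_of_nonneg_right hmono hexp0.le
          _ = Pf * Real.exp (C₀ * s) * Kp := by ring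
      have h4 : Pf * Real.exp (C₀ * s) * Kp < Kf * Kp := mul_lt_mul_of_pos_right hPfKf hKp0
      have h5 : P * Real.exp (C₀ * s) * Kf < Kp * Kf := by
        calc P * Real.exp (C₀ * s) * Kf ≤ Pf * Real.exp (C₀ * s) * Kp := h3
          _ < Kf * Kp := h4
          _ = Kp * Kf := by ring
      have h6 : P * Real.exp (C₀ * s) < Kp := lt_of_mul_lt_mul_right h5 hKf0.le
      exact h6.trans_le hKpH
    have hfin : P * E < G := by
      have hEle : E ≤ Real.exp (C₀ / 4 * s) := by
        rw [← hE, Real.exp_le_exp]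
        exact mul_le_mul_of_nonneg_right hcC hs0
      have hsplit : Real.exp (C₀ / 4 * s) * Real.exp (3 * C₀ / 4 * s) = Real.exp (C₀ * s) := by
        rw [← Real.exp_add]
        congr 1
        ring
      have h34 : 0 < Real.exp (3 * C₀ / 4 * s) := Real.exp_pos _
      have h7 : P * Real.exp (C₀ / 4 * s) * Real.exp (3 * C₀ / 4 * s) <
          G * Real.exp (3 * C₀ / 4 * s) := by
        calc P * Real.exp (C₀ / 4 * s) * Real.exp (3 * C₀ / 4 * s)
            = P * Real.exp (C₀ * s) := by rw [mul_assoc, hsplit]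
          _ < Y * G := hPexp
          _ ≤ Real.exp (3 * C₀ / 4 * s) * G := mul_le_mul_of_nonneg_right hE1 hG0.le
          _ = G * Real.exp (3 * C₀ / 4 * s) := by ring
      have h8 : P * Real.exp (C₀ / 4 * s) < G := lt_of_mul_lt_mul_right h7 h34.le
      calc P * E ≤ P * Real.exp (C₀ / 4 * s) := mul_le_mul_of_nonneg_left hEle hP0.le
        _ < G := h8
    exact hcon hfin.le

/-- **Composition.** `stub_saturate`, `stub_packing`, `stub_hostTriangles`, `stub_relativeCounting`
(+ the diagonal count `sextuple_card_le`, proved) ⇒ the crux `HyperoctahedralSubsets`, by name. -/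
theorem HyperoctahedralSubsets_of :
    Summit.MatrixMultiplication.MatrixMultiplication.Theses.SnSubsetDichotomy.HyperoctahedralSubsets := by
  -- constants from the two asymptotic stubs
  obtain ⟨lam, hlam, hRC0⟩ := relativeCounting'
  have hlog : 0 < Real.log lam := Real.log_pos hlam
  have hCF : (0 : ℝ) < 14 / Real.log lam := by positivity
  obtain ⟨C₀, hC₀, n₁, hHT⟩ := hostTriangles' (14 / Real.log lam) hCF
  obtain ⟨A, hA, CL, n₂, hRC⟩ := hRC0 (14 / Real.log lam) hCF 7 (by norm_num) C₀ hC₀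
  obtain ⟨B, rfl⟩ : ∃ B, A = B + 1 := ⟨A - 1, by omega⟩
  have hB : 1 ≤ B := by omega
  set c : ℝ := min (1 / 2) (C₀ / 4) with hc_def
  have hc : 0 < c := lt_min (by norm_num) (by linarith)
  have hc2 : c ≤ 1 / 2 := min_le_left _ _
  have hcC : c ≤ C₀ / 4 := min_le_right _ _
  obtain ⟨N₁, hN₁⟩ := eventually_E1 C₀ hC₀
  obtain ⟨N₂, hN₂⟩ := eventually_E2 lam CL c B hlam
  refine ⟨c, hc, max (max n₁ n₂) (max N₁ N₂) + 1, ?_⟩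
  intro n hn μ hμ X hX hT
  have hn1 : 1 ≤ n := le_trans (Nat.le_add_left 1 _) hn
  have hn' : max (max n₁ n₂) (max N₁ N₂) ≤ n := le_trans (Nat.le_succ _) hn
  have hnn₁ : n₁ ≤ n := le_trans (le_max_left _ _) (le_trans (le_max_left _ _) hn')
  have hnn₂ : n₂ ≤ n := le_trans (le_max_right _ _) (le_trans (le_max_left _ _) hn')
  have hnN₁ : N₁ ≤ n := le_trans (le_max_left _ _) (le_trans (le_max_right _ _) hn')
  have hnN₂ : N₂ ≤ n := le_trans (le_max_right _ _) (le_trans (le_max_right _ _) hn')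
  have hmain := main_estimate lam hlam B hB CL C₀ c hc hcC hc2 n hn1
    (hHT n hnn₁) (hRC n hnn₂) (hN₁ n hnN₁) (hN₂ n hnN₂) μ hμ X hX hT
  -- translate `∏|X i|·e^{c√n} ≤ n!·√(n!)` into the crux's shape
  have hF0 : (0 : ℝ) < (n.factorial : ℝ) := by exact_mod_cast n.factorial_pos
  have hprod : (((X 0).card * (X 1).card * (X 2).card : ℕ) : ℝ) = ∏ i, ((X i).card : ℝ) := by
    rw [Fin.prod_univ_three]
    push_cast
    ring
  have hrpow : (n.factorial : ℝ) ^ ((3 : ℝ) / 2) = (n.factorial : ℝ) * Real.sqrt (n.factorial : ℝ) := by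
    rw [show (3 : ℝ) / 2 = 1 + 1 / 2 by norm_num, Real.rpow_add hF0, Real.rpow_one,
      Real.sqrt_eq_rpow]
  rw [hprod, hrpow, Real.exp_neg, ← div_eq_mul_inv, le_div_iff₀ (Real.exp_pos _)]
  exact hmain

end Summit.MatrixMultiplication.MatrixMultiplication.Cruxes.HyperoctahedralSubsets.PerHostDescentRootedTriangles
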